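import Literature.MathematicalPhysics.QuantumFieldTheory.PlaquetteSystemTwistAgreement
import Literature.MathematicalPhysics.QuantumFieldTheory.FinTorusPlaquetteSystem
import HarnessLib

/-!
# Twist locality on 't Hooft's anisotropic `Fin`-box: all translates of the `(0,1)`-stack carry the same polymer activities,
# and the stack twist is invisible to polymers with fewer than `n₀ · n₁` plaquettes — uniformly in `n₂, n₃`

Topic `Literature/MathematicalPhysics/QuantumFieldTheory`; vocabulary of `FinTorusPlaquetteSystem.lean` (`finTorusSystem n₀ n₁ n₂ n₃ G`,
the coboundary formula `finTorusPlaquette_mul_links`, the translates `finTorusStack a b` and insertions `finTorusStackTwist z a b`)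
and of `PlaquetteSystemTwistAgreement.lean` (transport `PlaquetteSystem.polymerActivity_twistFamily_eq_of_mul_links`; translates
`PlaquetteSystem.polymerActivity_twistFamily_eq_of_translates`).  THEOREMS ONLY — the anisotropic form of `PlaquetteFieldTwistLocality.lean`
/ `CentralTwistLocality.lean` (symmetric tori), i.e. dw-p1's INFRA-MEMO F3 for LINE g21-A `MagneticFluxCeiling`:

* `polymerActivity_finTorusStackTwist_rotate_fst` / `_rotate_snd` — ONE STEP: the central link function `z` on the `1`-links
  `{y₀ = a+1, y₁ = b}` (resp. the `0`-links `{y₀ = a, y₁ = b+1}`) has plaquette coboundary `z·𝟙_{stack(a,b)} · z⁻¹·𝟙_{stack(a+1,b)}`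
  (resp. `z·𝟙_{stack(a,b+1)} · z⁻¹·𝟙_{stack(a,b)}`), so by transport the stack insertions at neighbouring positions have EQUAL polymer
  activities at every plaquette set (E. T. Tomboulis, arXiv:0707.2179 [Tomboulis2007Confinement] §4: "`𝒱` and `𝒱'` … cobound a set
  of bonds", the change of variables on those bonds); only `finRotate` as a permutation is used, no arithmetic in `Fin n`;
* ★ `polymerActivity_finTorusStackTwist_eq` — hence ALL `n₀ n₁` positions agree (iterate along the `finRotate` cycles through `0`);
* ★★ `polymerActivity_finTorusStackTwist_eq_of_card_lt` — a plaquette set with fewer than `n₀ · n₁` plaquettes misses a translate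
  (pigeonhole over the pairwise disjoint translates), so the stack-twisted family has the UNTWISTED polymer activity there.  The
  threshold is the AREA of the twisted plane; the transverse extents `n₂, n₃` do not enter (Ito–Seiler 2008 Thm 2.2 (1): asymmetric
  tori; Tomboulis 2007 (6.11)).

HONEST FRAMING: finite-volume identities; central `z` only; plane `(0,1)` only (TODO(general form): other planes by symmetry);
no estimate, no limit.  The resulting bound on `twistedPartitionFunctionAniso` is `AnisotropicTwistedPartitionFunctionStrongCoupling.lean`.
-/

noncomputable section

open MeasureTheory Finset
open scoped BigOperators

namespace Literature.MathematicalPhysics.QuantumFieldTheory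

variable {n₀ n₁ n₂ n₃ : ℕ}

/-! ### Moving the stack by one step: the two coboundaries -/

section Moves

variable {G : Type*} [Group G] [TopologicalSpace G] [IsTopologicalGroup G] [CompactSpace G] [MeasurableSpace G]
  [BorelSpace G]

/-- the six planes, for case analysis (plumbing). [folklore] -/
private theorem plane_cases (q : {q : Fin 4 × Fin 4 // q.1 < q.2}) :
    q = ⟨(0, 1), by decide⟩ ∨ q = ⟨(0, 2), by decide⟩ ∨ q = ⟨(0, 3), by decide⟩ ∨ q = ⟨(1, 2), by decide⟩ ∨
      q = ⟨(1, 3), by decide⟩ ∨ q = ⟨(2, 3), by decide⟩ := by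
  revert q
  decide

omit [TopologicalSpace G] [IsTopologicalGroup G] [CompactSpace G] [MeasurableSpace G] [BorelSpace G] in
/-- The coboundary of the `1`-link function `[y₀ = a + 1, y₁ = b] z` corrects the stack insertion at `(a + 1, b)` into the one at
`(a, b)` (plumbing: case analysis over the six planes). [cite: Tomboulis2007Confinement, §4 (text after eq. (4.1))] -/
private theorem stackTwist_mul_coboundary_fst (z : G) (a : Fin n₀) (b : Fin n₁) (x : FinTorusSite n₀ n₁ n₂ n₃)
    (q : {q : Fin 4 × Fin 4 // q.1 < q.2}) :
    finTorusStackTwist n₂ n₃ z (finRotate n₀ a) b (x, q) *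
        ((fun l : FinTorusLink n₀ n₁ n₂ n₃ => if l.2 = 1 ∧ l.1.1 = finRotate n₀ a ∧ l.1.2.1 = b then z else 1) (x, q.1.1) *
          (fun l : FinTorusLink n₀ n₁ n₂ n₃ => if l.2 = 1 ∧ l.1.1 = finRotate n₀ a ∧ l.1.2.1 = b then z else 1)
            (x.shift q.1.1, q.1.2) *
          ((fun l : FinTorusLink n₀ n₁ n₂ n₃ => if l.2 = 1 ∧ l.1.1 = finRotate n₀ a ∧ l.1.2.1 = b then z else 1)
            (x.shift q.1.2, q.1.1))⁻¹ *
          ((fun l : FinTorusLink n₀ n₁ n₂ n₃ => if l.2 = 1 ∧ l.1.1 = finRotate n₀ a ∧ l.1.2.1 = b then z else 1)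
            (x, q.1.2))⁻¹) =
      finTorusStackTwist n₂ n₃ z a b (x, q) := by
  rcases plane_cases q with rfl | rfl | rfl | rfl | rfl | rfl <;>
    simp only [finTorusStackTwist_apply, finTorusSite_shift_zero_fst, finTorusSite_shift_zero_snd_fst,
      finTorusSite_shift_one_fst, finTorusSite_shift_one_snd_fst, finTorusSite_shift_two_fst,
      finTorusSite_shift_two_snd_fst, finTorusSite_shift_three_fst, finTorusSite_shift_three_snd_fst,
      EmbeddingLike.apply_eq_iff_eq, true_and, false_and, if_false, Fin.isValue, Fin.reduceEq, Subtype.mk.injEq,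
      Prod.mk.injEq, and_self, one_mul, mul_one, inv_one]
  all_goals (split_ifs <;> simp)

omit [TopologicalSpace G] [IsTopologicalGroup G] [CompactSpace G] [MeasurableSpace G] [BorelSpace G] in
/-- The coboundary of the `0`-link function `[y₀ = a, y₁ = b + 1] z` corrects the stack insertion at `(a, b)` into the one at
`(a, b + 1)` (plumbing). [cite: Tomboulis2007Confinement, §4 (text after eq. (4.1))] -/
private theorem stackTwist_mul_coboundary_snd (z : G) (a : Fin n₀) (b : Fin n₁) (x : FinTorusSite n₀ n₁ n₂ n₃)
    (q : {q : Fin 4 × Fin 4 // q.1 < q.2}) :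
    finTorusStackTwist n₂ n₃ z a b (x, q) *
        ((fun l : FinTorusLink n₀ n₁ n₂ n₃ => if l.2 = 0 ∧ l.1.1 = a ∧ l.1.2.1 = finRotate n₁ b then z else 1) (x, q.1.1) *
          (fun l : FinTorusLink n₀ n₁ n₂ n₃ => if l.2 = 0 ∧ l.1.1 = a ∧ l.1.2.1 = finRotate n₁ b then z else 1)
            (x.shift q.1.1, q.1.2) *
          ((fun l : FinTorusLink n₀ n₁ n₂ n₃ => if l.2 = 0 ∧ l.1.1 = a ∧ l.1.2.1 = finRotate n₁ b then z else 1)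
            (x.shift q.1.2, q.1.1))⁻¹ *
          ((fun l : FinTorusLink n₀ n₁ n₂ n₃ => if l.2 = 0 ∧ l.1.1 = a ∧ l.1.2.1 = finRotate n₁ b then z else 1)
            (x, q.1.2))⁻¹) =
      finTorusStackTwist n₂ n₃ z a (finRotate n₁ b) (x, q) := by
  rcases plane_cases q with rfl | rfl | rfl | rfl | rfl | rfl <;>
    simp only [finTorusStackTwist_apply, finTorusSite_shift_zero_fst, finTorusSite_shift_zero_snd_fst,
      finTorusSite_shift_one_fst, finTorusSite_shift_one_snd_fst, finTorusSite_shift_two_fst,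
      finTorusSite_shift_two_snd_fst, finTorusSite_shift_three_fst, finTorusSite_shift_three_snd_fst,
      EmbeddingLike.apply_eq_iff_eq, true_and, false_and, if_false, Fin.isValue, Fin.reduceEq, Subtype.mk.injEq,
      Prod.mk.injEq, and_self, one_mul, mul_one, inv_one]
  all_goals (split_ifs <;> simp)

/-- **Moving the stack in direction `0`.**  The central link function `c = z` on the `1`-links `(y, 1)` with `y₀ = a + 1`,
`y₁ = b` has plaquette coboundary `δc = z` on the stack at `(a, b)` and `z⁻¹` on the stack at `(a + 1, b)` (and `1` on
every other plaquette); hence the twisted families at `(a + 1, b)` and at `(a, b)` have the same polymer activities at every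
plaquette set (arXiv:0707.2179 §4: "`𝒱` and `𝒱'` … cobound a set of bonds"). [cite: Tomboulis2007Confinement, §4 (text after eq. (4.1))] -/
theorem polymerActivity_finTorusStackTwist_rotate_fst {z : G} (hz : z ∈ Subgroup.center G) (a : Fin n₀) (b : Fin n₁)
    (w : FinTorusPlaquette n₀ n₁ n₂ n₃ → G → ℝ) (X : Finset (FinTorusPlaquette n₀ n₁ n₂ n₃)) :
    (finTorusSystem n₀ n₁ n₂ n₃ G).polymerActivity (twistFamily (finTorusStackTwist n₂ n₃ z (finRotate n₀ a) b) w) X =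
      (finTorusSystem n₀ n₁ n₂ n₃ G).polymerActivity (twistFamily (finTorusStackTwist n₂ n₃ z a b) w) X := by
  let c : FinTorusLink n₀ n₁ n₂ n₃ → G := fun l => if l.2 = 1 ∧ l.1.1 = finRotate n₀ a ∧ l.1.2.1 = b then z else 1
  have hc : ∀ l, c l ∈ Subgroup.center G := fun l => by
    dsimp only [c]
    split_ifs
    · exact hz
    · exact Subgroup.one_mem _
  rw [(finTorusSystem n₀ n₁ n₂ n₃ G).polymerActivity_twistFamily_eq_of_mul_links c
    (σ := fun p => c (p.1, p.2.1.1) * c (p.1.shift p.2.1.1, p.2.1.2) * (c (p.1.shift p.2.1.2, p.2.1.1))⁻¹ * (c (p.1, p.2.1.2))⁻¹)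
    (fun U p => finTorusPlaquette_mul_links c hc U p.1 p.2.1.1 p.2.1.2)]
  have key : (fun p : FinTorusPlaquette n₀ n₁ n₂ n₃ => finTorusStackTwist n₂ n₃ z (finRotate n₀ a) b p *
      (c (p.1, p.2.1.1) * c (p.1.shift p.2.1.1, p.2.1.2) * (c (p.1.shift p.2.1.2, p.2.1.1))⁻¹ * (c (p.1, p.2.1.2))⁻¹)) =
      finTorusStackTwist n₂ n₃ z a b :=
    funext fun p => stackTwist_mul_coboundary_fst z a b p.1 p.2
  rw [key]

/-- **Moving the stack in direction `1`.**  The central link function `c = z` on the `0`-links `(y, 0)` with `y₀ = a`,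
`y₁ = b + 1` has coboundary `z` on the stack at `(a, b + 1)` and `z⁻¹` on the stack at `(a, b)`; hence the twisted families
at `(a, b)` and at `(a, b + 1)` have the same polymer activities. [cite: Tomboulis2007Confinement, §4 (text after eq. (4.1))] -/
theorem polymerActivity_finTorusStackTwist_rotate_snd {z : G} (hz : z ∈ Subgroup.center G) (a : Fin n₀) (b : Fin n₁)
    (w : FinTorusPlaquette n₀ n₁ n₂ n₃ → G → ℝ) (X : Finset (FinTorusPlaquette n₀ n₁ n₂ n₃)) :
    (finTorusSystem n₀ n₁ n₂ n₃ G).polymerActivity (twistFamily (finTorusStackTwist n₂ n₃ z a b) w) X =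
      (finTorusSystem n₀ n₁ n₂ n₃ G).polymerActivity (twistFamily (finTorusStackTwist n₂ n₃ z a (finRotate n₁ b)) w) X := by
  let c : FinTorusLink n₀ n₁ n₂ n₃ → G := fun l => if l.2 = 0 ∧ l.1.1 = a ∧ l.1.2.1 = finRotate n₁ b then z else 1
  have hc : ∀ l, c l ∈ Subgroup.center G := fun l => by
    dsimp only [c]
    split_ifs
    · exact hz
    · exact Subgroup.one_mem _
  rw [(finTorusSystem n₀ n₁ n₂ n₃ G).polymerActivity_twistFamily_eq_of_mul_links c
    (σ := fun p => c (p.1, p.2.1.1) * c (p.1.shift p.2.1.1, p.2.1.2) * (c (p.1.shift p.2.1.2, p.2.1.1))⁻¹ * (c (p.1, p.2.1.2))⁻¹)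
    (fun U p => finTorusPlaquette_mul_links c hc U p.1 p.2.1.1 p.2.1.2)]
  have key : (fun p : FinTorusPlaquette n₀ n₁ n₂ n₃ => finTorusStackTwist n₂ n₃ z a b p *
      (c (p.1, p.2.1.1) * c (p.1.shift p.2.1.1, p.2.1.2) * (c (p.1.shift p.2.1.2, p.2.1.1))⁻¹ * (c (p.1, p.2.1.2))⁻¹)) =
      finTorusStackTwist n₂ n₃ z a (finRotate n₁ b) :=
    funext fun p => stackTwist_mul_coboundary_snd z a b p.1 p.2
  rw [key]

/-- Every element of `Fin (m+1)` is reached from `0` by iterating `finRotate`. [folklore] -/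
private theorem exists_iterate_finRotate_zero_eq {m : ℕ} (a : Fin (m + 1)) : ∃ k : ℕ, (finRotate (m + 1))^[k] 0 = a := by
  have hval : ∀ k : ℕ, k < m + 1 → (((finRotate (m + 1))^[k] 0 : Fin (m + 1)) : ℕ) = k := by
    intro k hk
    induction k with
    | zero => simp
    | succ k ih =>
      have hk' := ih (by omega)
      have hne : (finRotate (m + 1))^[k] 0 ≠ Fin.last m := by
        intro h
        have h' := congrArg Fin.val h
        rw [hk', Fin.val_last] at h'
        omega
      rw [Function.iterate_succ_apply', coe_finRotate_of_ne_last hne, hk']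
  exact ⟨a.val, Fin.ext (hval a.val a.isLt)⟩

/-- **All translates of the stack carry the same polymer activities** (central `z`): the twisted family at `(a, b)` and at
`(a', b')` agree on every plaquette set — the lattice form of "for central `z` the position of the stack is immaterial"
(Greensite (4.43)) at the level of polymer activities, arXiv:0707.2179 §4.
[cite: Tomboulis2007Confinement, §4 (text after eq. (4.1))] [cite: Greensite2011, §4.4 (4.43)] -/
theorem polymerActivity_finTorusStackTwist_eq {z : G} (hz : z ∈ Subgroup.center G) (a a' : Fin n₀) (b b' : Fin n₁)
    (w : FinTorusPlaquette n₀ n₁ n₂ n₃ → G → ℝ) (X : Finset (FinTorusPlaquette n₀ n₁ n₂ n₃)) :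
    (finTorusSystem n₀ n₁ n₂ n₃ G).polymerActivity (twistFamily (finTorusStackTwist n₂ n₃ z a b) w) X =
      (finTorusSystem n₀ n₁ n₂ n₃ G).polymerActivity (twistFamily (finTorusStackTwist n₂ n₃ z a' b') w) X := by
  -- both sides equal the activity of the stack at `(0, 0)`: move in direction 0, then in direction 1
  obtain ⟨m₀, rfl⟩ := Nat.exists_eq_succ_of_ne_zero (Nat.pos_iff_ne_zero.1 (Fin.pos a))
  obtain ⟨m₁, rfl⟩ := Nat.exists_eq_succ_of_ne_zero (Nat.pos_iff_ne_zero.1 (Fin.pos b))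
  have h0 : ∀ (k : ℕ) (u : Fin (m₀ + 1)) (v : Fin (m₁ + 1)),
      (finTorusSystem (m₀ + 1) (m₁ + 1) n₂ n₃ G).polymerActivity
          (twistFamily (finTorusStackTwist n₂ n₃ z ((finRotate (m₀ + 1))^[k] u) v) w) X =
        (finTorusSystem (m₀ + 1) (m₁ + 1) n₂ n₃ G).polymerActivity (twistFamily (finTorusStackTwist n₂ n₃ z u v) w) X := by
    intro k u v
    induction k with
    | zero => rfl
    | succ k ih => rw [Function.iterate_succ_apply', polymerActivity_finTorusStackTwist_rotate_fst hz, ih]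
  have h1 : ∀ (k : ℕ) (u : Fin (m₀ + 1)) (v : Fin (m₁ + 1)),
      (finTorusSystem (m₀ + 1) (m₁ + 1) n₂ n₃ G).polymerActivity (twistFamily (finTorusStackTwist n₂ n₃ z u v) w) X =
        (finTorusSystem (m₀ + 1) (m₁ + 1) n₂ n₃ G).polymerActivity
          (twistFamily (finTorusStackTwist n₂ n₃ z u ((finRotate (m₁ + 1))^[k] v)) w) X := by
    intro k u v
    induction k with
    | zero => rfl
    | succ k ih => rw [Function.iterate_succ_apply', ← polymerActivity_finTorusStackTwist_rotate_snd hz, ih]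
  have key : ∀ (u : Fin (m₀ + 1)) (v : Fin (m₁ + 1)),
      (finTorusSystem (m₀ + 1) (m₁ + 1) n₂ n₃ G).polymerActivity (twistFamily (finTorusStackTwist n₂ n₃ z u v) w) X =
        (finTorusSystem (m₀ + 1) (m₁ + 1) n₂ n₃ G).polymerActivity (twistFamily (finTorusStackTwist n₂ n₃ z 0 0) w) X := by
    intro u v
    obtain ⟨k₀, hk₀⟩ := exists_iterate_finRotate_zero_eq u
    obtain ⟨k₁, hk₁⟩ := exists_iterate_finRotate_zero_eq v
    rw [← hk₀, h0 k₀ 0 v, ← hk₁, ← h1 k₁ 0 0]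
  rw [key a b, key a' b']

/-- **★ The twist of one stack is invisible to polymers with fewer than `n₀ · n₁` plaquettes** (central `z`, any family of
weights, any box `n₀ × n₁ × n₂ × n₃`): such a polymer misses one of the `n₀ n₁` pairwise disjoint translates of the stack, and all
translates carry the same polymer activities.  The threshold is the area of the twisted plane and does NOT involve the
transverse extents `n₂, n₃` (arXiv:0707.2179 (6.11): `A = |𝒱|`-independent winding condition; Ito–Seiler 2008 Thm 2.2 (1):
asymmetric tori `L₃L₄ → ∞` at fixed `L₁L₂`). [cite: Tomboulis2007Confinement, §6.2 eqs. (6.10)–(6.11)] [cite: ItoSeiler2008Further, §2 Thm 2.2 (1)] -/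
theorem polymerActivity_finTorusStackTwist_eq_of_card_lt {z : G} (hz : z ∈ Subgroup.center G) (a : Fin n₀) (b : Fin n₁)
    (w : FinTorusPlaquette n₀ n₁ n₂ n₃ → G → ℝ) {X : Finset (FinTorusPlaquette n₀ n₁ n₂ n₃)} (hX : X.card < n₀ * n₁) :
    (finTorusSystem n₀ n₁ n₂ n₃ G).polymerActivity (twistFamily (finTorusStackTwist n₂ n₃ z a b) w) X =
      (finTorusSystem n₀ n₁ n₂ n₃ G).polymerActivity w X := by
  have hcard : X.card < Fintype.card (Fin n₀ × Fin n₁) := by simpa using hX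
  exact (finTorusSystem n₀ n₁ n₂ n₃ G).polymerActivity_twistFamily_eq_of_translates
    (T := fun ab : Fin n₀ × Fin n₁ => finTorusStack n₂ n₃ ab.1 ab.2) (fun ab ab' h => disjoint_finTorusStack h)
    (t := fun ab : Fin n₀ × Fin n₁ => finTorusStackTwist n₂ n₃ z ab.1 ab.2)
    (fun ab p hp => finTorusStackTwist_of_not_mem hp) w
    (fun ab ab' Y => polymerActivity_finTorusStackTwist_eq hz ab.1 ab'.1 ab.2 ab'.2 w Y) (a, b) hcard

end Moves

end Literature.MathematicalPhysics.QuantumFieldTheory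

end
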